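import Literature.MathematicalPhysics.QuantumLattice.HubbardTTPrimeThermalPressureLimit
import HarnessLib

/-!
# HOT–COLD corner transport of a certified thermal pressure ceiling: a hot cap at ONE `(β_M; s_M, U_M)` plus a `T = 0` floor at
# ONE `(s_C, U_C)` bound the half-filling pressure on a whole `(t′, U)` cell by joint convexity in the β-scaled couplings

Topic `MathematicalPhysics/QuantumLattice` (family `hubbard`); written 2026-08-31 by `hubbard-downfold-unc-2` (g43, MO-S1 filling lane of the
Hubbard material oracle), companion of `HubbardTTPrimeAtomicCornerPressureCeiling` (same session: cold interacting corner + hot ATOMIC corner).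

WHY. The canonical pressure `p(β; t, s, U; n)` is jointly convex in `(βt, βs, βU)` on `{U ≥ 0}` (`pressureTT'_le_sum`). The tree holds a handful of
CERTIFIED hot ceilings `p(β_M; 1, s_M, U_M; 1) ≤ π_M` at half filling (staircase-Markov free-energy certificates, claim nodes
`cert_feC1tt_stair221_tpm5o16_U15o2_n1_b*`, `cert_feC1_stair221_U8_n1_b*`: `(s_M, U_M) = (−5/16, 15/2), (−3/16, 15/2), (0, 8)`, `β_M ∈ {3/2, 2, 5/2, 3}`,
[cite: PoulinHastings2011, eqs. (3)–(8)]) which so far served only the cells `t′ ∈ [−5/16, −3/16]`, `U ≥ 15/2` (convexity in `t′` between the two corners,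
antitone in `U`). Pairing ONE hot corner with ONE COLD corner — the a-priori window `p(β_C; 1, s_C, U_C; 1) ≤ 2 log 2 − β_C·e(1, s_C, U_C, 1)` at a
`T = 0` floor `F ≤ e(1, s_C, U_C, 1)` with `s_C` on the FAR side of the target — transports the certificate to every `s ∈ [s_C, s_M]`:
with `f_M(s) = (s − s_C)/(s_M − s_C)`, `f_C = 1 − f_M`, `w = β_h f_M/β_M < 1`, `β_C = β_h f_C/(1 − w)` and `U₀ = f_M U_M + f_C U_C`,
`β_h·(1, s, U₀) = w·[β_M (1, s_M, U_M)] + (1 − w)·[β_C (1, s_C, U_C)]`, hence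

  `p(β_h; 1, s, U; 1) ≤ p(β_h; 1, s, U₀; 1) ≤ w π_M + (1 − w)·2 log 2 − β_h f_C(s) F`   for every `U ≥ U₀` (antitone in `U`),

AFFINE in `s` — exactly the `hπ₂` hypothesis shape of the hot-anchor laws of `Summits/…/Observables/PhaseSeparationExclusionBox*Thermal*`, whose dense
bracket `b·(Q₂(s) + β_h L(s))` becomes `b·(w(s) π_M + (1 − w(s))·2c₂ + β_h (L(s) − f_C(s) F))`. SIZE (exact re-pricing of landed far-strip `(≤ 1/2 ∣ ≥ 1)`
words with the tree's `n = 1` columns as cold corners): `β₀ 16 → 11` on `[71/10, 8] × [−9/20, −2/5]`, `13 → 9` on `[71/10, 8] × [−2/5, −7/20]`, `23 → 18` on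
`[6, 32/5]`, `20 → 14` on `[32/5, 13/2]`; nothing below `U ≈ 5.3` (the `U`-budget `f_M U_M + f_C U_C ≤ U₁` forces `f_M → 0`).

* `hotColdCorner_halfFilling_on_cell` — the reader shape above (and `hotColdCornerMirror_halfFilling_on_cell`, the mirror image with the cold corner on the right, `s_M ≤ s₁ ≤ s₂ ≤ s_C`, appended g43 for hot caps LEFT of a cell, e.g. a far-strip `(−2/5, 5)` cap serving `[−2/5, −7/20]`) (`c₂ = 0.6931471808 ≥ log 2`, Mathlib), hypotheses: the hot cap, the cold floor,
  `s_C ≤ s₁ ≤ s₂ ≤ s_M`, `s_C < s_M`, `β_h (s₂ − s_C) < β_M (s_M − s_C)` (`w < 1`), and the `U`-budget at both ends of the cell.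

Everything is PROVED (standard axioms); no definition, no named fact, no number of record. HONEST SCOPE: a convexity / monotonicity transport lemma; the hot
cap is whatever certified ceiling the consumer names (BY NAME on its claim node); not a phase word.

## Mathlib / tree search

REUSED: `pressureTT'_le_sum`, `pressureTT'_mem_Icc`, `pressureTT'_anti_U` (`HubbardTTPrimeThermalPressureLimit`); Mathlib `Real.log_two_lt_d9`,
`Real.binEntropy_two_inv`. Consumers of `pressureTT'_le_sum` so far: `t′`-chords of two hot caps only
(`Certificates/HubbardSquare_n7o8_tpbox_thermal_hotCaps_convexC1tt`, `…_n1_tpm5o16_tpm3o16_U15o2_thermal_C1nodesTT…`), no hot–cold pair (2026-08-31).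

## References

* R. B. Israel, *Convexity in the Theory of Lattice Gases* (1979), Thm. I.2.4 (convexity of the pressure in the interaction). [cite: Israel1979, Thm. I.2.4]
* D. Poulin, M. B. Hastings, Phys. Rev. Lett. 106 (2011) 080403, eqs. (3)–(8) (Markov entropy-decomposition free-energy certificates).
  [cite: PoulinHastings2011, eqs. (3)–(8)]
* R. B. Griffiths, J. Math. Phys. 5 (1964) 1215, §II (monotonicity in the coupling). [cite: Griffiths1966, §II]
-/

noncomputable section

namespace Literature.MathematicalPhysics.QuantumLattice

open _root_.Filter
open scoped _root_.Topology BigOperators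

namespace ThermodynamicLimit

/-- **HOT–COLD CORNER TRANSPORT ON A CELL** (`t = 1`, `n = 1`): a hot ceiling `p(β_M; 1, s_M, U_M; 1) ≤ π_M` (`β_M > 0`, `U_M ≥ 0`), a cold
floor `F ≤ e(1, s_C, U_C, 1)` (`U_C ≥ 0`) with `s_C ≤ s₁ ≤ s₂ ≤ s_M`, `s_C < s_M`, a hot inverse temperature `β_h ≥ 0` with
`β_h (s₂ − s_C) < β_M (s_M − s_C)`, and the `U`-budget `(s_i − s_C) U_M + (s_M − s_i) U_C ≤ U₁ (s_M − s_C)` at `i = 1, 2` give, for every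
`s ∈ [s₁, s₂]` and `U ∈ [U₁, U₂]`,
`p(β_h; 1, s, U; 1) ≤ (1 − w(s))·2c₂ + w(s)·π_M − β_h f_C(s)·F`, `w(s) = β_h (s − s_C)/((s_M − s_C) β_M)`, `f_C(s) = (s_M − s)/(s_M − s_C)`,
`c₂ = 0.6931471808` (joint convexity with the corners `β_M (1, s_M, U_M)` and `β_C (1, s_C, U_C)`, then antitone in `U`).
[cite: Israel1979, Thm. I.2.4] [cite: Griffiths1966, §II] -/
theorem hotColdCorner_halfFilling_on_cell {s₁ s₂ U₁ U₂ sM UM βM piM sC UC Fc βh : ℝ}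
    (hβM : 0 < βM) (hUM : 0 ≤ UM) (hUC : 0 ≤ UC) (hM : pressureTT' βM 1 sM UM 1 ≤ piM)
    (hF : Fc ≤ energyDensityTT' 1 sC UC 1) (hβh : 0 ≤ βh) (hsC : sC ≤ s₁) (hsM : s₂ ≤ sM) (hCM : sC < sM)
    (hw : βh * (s₂ - sC) < βM * (sM - sC))
    (hU1 : (s₁ - sC) * UM + (sM - s₁) * UC ≤ U₁ * (sM - sC))
    (hU2 : (s₂ - sC) * UM + (sM - s₂) * UC ≤ U₁ * (sM - sC)) :
    ∀ s ∈ Set.Icc s₁ s₂, ∀ U ∈ Set.Icc U₁ U₂,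
      pressureTT' βh 1 s U 1 ≤ (1 - βh * ((s - sC) / (sM - sC)) / βM) * (2 * (6931471808 / 10 ^ 10)) +
        βh * ((s - sC) / (sM - sC)) / βM * piM - βh * ((sM - s) / (sM - sC)) * Fc := by
  intro s hs U hU
  have hden : 0 < sM - sC := by linarith
  have hdne : sM - sC ≠ 0 := hden.ne'
  have hβMne : βM ≠ 0 := hβM.ne'
  set fM : ℝ := (s - sC) / (sM - sC) with hfM
  set fC : ℝ := (sM - s) / (sM - sC) with hfC
  have hfM0 : 0 ≤ fM := div_nonneg (by linarith [hs.1]) hden.le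
  have hfC0 : 0 ≤ fC := div_nonneg (by linarith [hs.2]) hden.le
  have hsum : fM + fC = 1 := by rw [hfM, hfC]; field_simp; ring
  have hsmix : fM * sM + fC * sC = s := by rw [hfM, hfC]; field_simp; ring
  set w : ℝ := βh * fM / βM with hw'
  have hw0 : 0 ≤ w := div_nonneg (mul_nonneg hβh hfM0) hβM.le
  have hw1 : w < 1 := by
    rw [hw', div_lt_one hβM, hfM]
    have h1 : βh * (s - sC) ≤ βh * (s₂ - sC) := mul_le_mul_of_nonneg_left (by linarith [hs.2]) hβh
    calc βh * ((s - sC) / (sM - sC)) = βh * (s - sC) / (sM - sC) := by ring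
      _ < βM := by rw [div_lt_iff₀ hden]; linarith
  have h1w : 0 < 1 - w := by linarith
  have h1wne : (1 - w) ≠ 0 := h1w.ne'
  -- the reduced coupling U₀ = fM UM + fC UC ∈ [0, U₁]
  set U₀ : ℝ := fM * UM + fC * UC with hU₀
  have hU₀0 : 0 ≤ U₀ := add_nonneg (mul_nonneg hfM0 hUM) (mul_nonneg hfC0 hUC)
  have hU₀1 : U₀ ≤ U₁ := by
    -- the budget is affine in s: combine the two end inequalities with weights θ = (s - s₁)/(s₂ - s₁) when s₁ < s₂
    have key : (s - sC) * UM + (sM - s) * UC ≤ U₁ * (sM - sC) := by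
      rcases eq_or_lt_of_le (show s₁ ≤ s₂ from hs.1.trans hs.2) with h12 | h12
      · have : s = s₁ := le_antisymm (h12 ▸ hs.2) hs.1
        rw [this]; exact hU1
      · have hθ0 : 0 ≤ (s - s₁) / (s₂ - s₁) := div_nonneg (by linarith [hs.1]) (by linarith)
        have hθ1 : 0 ≤ (s₂ - s) / (s₂ - s₁) := div_nonneg (by linarith [hs.2]) (by linarith)
        have e1 := mul_le_mul_of_nonneg_left hU1 hθ1
        have e2 := mul_le_mul_of_nonneg_left hU2 hθ0
        have hid : (s₂ - s) / (s₂ - s₁) * ((s₁ - sC) * UM + (sM - s₁) * UC) +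
            (s - s₁) / (s₂ - s₁) * ((s₂ - sC) * UM + (sM - s₂) * UC) = (s - sC) * UM + (sM - s) * UC := by
          field_simp; ring
        have hid2 : (s₂ - s) / (s₂ - s₁) * (U₁ * (sM - sC)) + (s - s₁) / (s₂ - s₁) * (U₁ * (sM - sC)) =
            U₁ * (sM - sC) := by
          field_simp; ring
        linarith [hid, hid2]
    rw [hU₀, hfM, hfC, div_mul_eq_mul_div, div_mul_eq_mul_div, ← add_div, div_le_iff₀ hden]
    linarith
  -- corner data
  set βC : ℝ := βh * fC / (1 - w) with hβC
  have hβC0 : 0 ≤ βC := div_nonneg (mul_nonneg hβh hfC0) h1w.le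
  have e1 : w * βM = βh * fM := by rw [hw']; field_simp
  have e2 : (1 - w) * βC = βh * fC := by rw [hβC]; field_simp
  have uM : pressureTT' βM 1 sM UM 1 ≤ piM := hM
  have uC : pressureTT' βC 1 sC UC 1 ≤ 2 * Real.log 2 - βC * Fc := by
    have h := (pressureTT'_mem_Icc hβC0 1 sC hUC zero_le_one one_lt_two).2
    have hH : Real.binEntropy ((1 : ℝ) / 2) = Real.log 2 := by
      rw [one_div]; exact Real.binEntropy_two_inv
    rw [hH] at h
    have : βC * Fc ≤ βC * energyDensityTT' 1 sC UC 1 := mul_le_mul_of_nonneg_left hF hβC0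
    linarith
  have hsumC := pressureTT'_le_sum zero_le_one one_lt_two (Finset.univ : Finset (Fin 2)) ![w, 1 - w] ![βM, βC]
    ![((1 : ℝ), sM, UM), ((1 : ℝ), sC, UC)] ![piM, 2 * Real.log 2 - βC * Fc]
    (by intro k _; fin_cases k <;> simp <;> linarith) (by simp [Fin.sum_univ_two])
    (by intro k _; fin_cases k <;> simp <;> positivity) (by intro k _; fin_cases k <;> simp <;> linarith) hβh
    (q := ((1 : ℝ), s, U₀)) (by simpa using hU₀0)
    (by
      have ht : w * βM + (1 - w) * βC = βh := by
        rw [e1, e2, ← mul_add, hsum, mul_one]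
      have hs' : w * (βM * sM) + (1 - w) * (βC * sC) = βh * s := by
        rw [← mul_assoc, ← mul_assoc, e1, e2]; linear_combination βh * hsmix
      have hU' : w * (βM * UM) + (1 - w) * (βC * UC) = βh * U₀ := by
        rw [← mul_assoc, ← mul_assoc, e1, e2, hU₀]; ring
      ext <;> simp [Fin.sum_univ_two] <;> linarith [ht, hs', hU'])
    (by intro k _; fin_cases k
        · simpa using uM
        · simpa using uC)
  have h2 := hsumC
  simp only [Fin.sum_univ_two, Matrix.cons_val_zero, Matrix.cons_val_one] at h2
  -- h2 : p(βh; 1, s, U₀; 1) ≤ w * piM + (1 - w) * (2 log 2 - βC * Fc)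
  have hanti : pressureTT' βh 1 s U 1 ≤ pressureTT' βh 1 s U₀ 1 :=
    pressureTT'_anti_U zero_le_one one_lt_two hβh 1 s hU₀0 (hU₀1.trans hU.1)
  have hL : Real.log 2 ≤ 6931471808 / 10 ^ 10 := by
    have := Real.log_two_lt_d9; norm_num at this ⊢; linarith
  have hcold : (1 - w) * (2 * Real.log 2 - βC * Fc) = (1 - w) * (2 * Real.log 2) - βh * fC * Fc := by
    rw [← e2]; ring
  have hmono : (1 - w) * (2 * Real.log 2) ≤ (1 - w) * (2 * (6931471808 / 10 ^ 10)) :=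
    mul_le_mul_of_nonneg_left (by linarith) h1w.le
  have hgoal : w * piM + (1 - w) * (2 * Real.log 2 - βC * Fc) ≤
      (1 - w) * (2 * (6931471808 / 10 ^ 10)) + w * piM - βh * fC * Fc := by
    rw [hcold]; linarith
  calc pressureTT' βh 1 s U 1 ≤ pressureTT' βh 1 s U₀ 1 := hanti
    _ ≤ w * piM + (1 - w) * (2 * Real.log 2 - βC * Fc) := h2
    _ ≤ (1 - w) * (2 * (6931471808 / 10 ^ 10)) + w * piM - βh * fC * Fc := hgoal
    _ = (1 - βh * ((s - sC) / (sM - sC)) / βM) * (2 * (6931471808 / 10 ^ 10)) +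
        βh * ((s - sC) / (sM - sC)) / βM * piM - βh * ((sM - s) / (sM - sC)) * Fc := by
          rw [hw', hfM, hfC]

/-- **HOT–COLD CORNER TRANSPORT ON A CELL, MIRROR IMAGE** (`t = 1`, `n = 1`; cold corner on the RIGHT): a hot ceiling
`p(β_M; 1, s_M, U_M; 1) ≤ π_M` (`β_M > 0`, `U_M ≥ 0`), a cold floor `F ≤ e(1, s_C, U_C, 1)` (`U_C ≥ 0`) with `s_M ≤ s₁ ≤ s₂ ≤ s_C`,
`s_M < s_C`, `β_h ≥ 0` with `β_h (s_C − s₁) < β_M (s_C − s_M)`, and the `U`-budget `(s_C − s_i) U_M + (s_i − s_M) U_C ≤ U₁ (s_C − s_M)` at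
`i = 1, 2` give, for every `s ∈ [s₁, s₂]` and `U ∈ [U₁, U₂]`,
`p(β_h; 1, s, U; 1) ≤ (1 − w(s))·2c₂ + w(s)·π_M − β_h f_C(s)·F` with `w(s) = β_h (s_C − s)/((s_C − s_M) β_M)`, `f_C(s) = (s − s_M)/(s_C − s_M)`,
`c₂ = 0.6931471808` — the same joint-convexity decomposition `β_h·(1, s, U₀) = w·[β_M (1, s_M, U_M)] + (1 − w)·[β_C (1, s_C, U_C)]` as
`hotColdCorner_halfFilling_on_cell`, for hot caps to the LEFT of the cell (e.g. a far-strip `(−2/5, 5)` ceiling serving `[−2/5, −7/20]`).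
[cite: Israel1979, Thm. I.2.4] [cite: Griffiths1966, §II] -/
theorem hotColdCornerMirror_halfFilling_on_cell {s₁ s₂ U₁ U₂ sM UM βM piM sC UC Fc βh : ℝ}
    (hβM : 0 < βM) (hUM : 0 ≤ UM) (hUC : 0 ≤ UC) (hM : pressureTT' βM 1 sM UM 1 ≤ piM)
    (hF : Fc ≤ energyDensityTT' 1 sC UC 1) (hβh : 0 ≤ βh) (hsM : sM ≤ s₁) (hsC : s₂ ≤ sC) (hMC : sM < sC)
    (hw : βh * (sC - s₁) < βM * (sC - sM))
    (hU1 : (sC - s₁) * UM + (s₁ - sM) * UC ≤ U₁ * (sC - sM))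
    (hU2 : (sC - s₂) * UM + (s₂ - sM) * UC ≤ U₁ * (sC - sM)) :
    ∀ s ∈ Set.Icc s₁ s₂, ∀ U ∈ Set.Icc U₁ U₂,
      pressureTT' βh 1 s U 1 ≤ (1 - βh * ((sC - s) / (sC - sM)) / βM) * (2 * (6931471808 / 10 ^ 10)) +
        βh * ((sC - s) / (sC - sM)) / βM * piM - βh * ((s - sM) / (sC - sM)) * Fc := by
  intro s hs U hU
  have hden : 0 < sC - sM := by linarith
  have hdne : sC - sM ≠ 0 := hden.ne'
  have hβMne : βM ≠ 0 := hβM.ne'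
  set fM : ℝ := (sC - s) / (sC - sM) with hfM
  set fC : ℝ := (s - sM) / (sC - sM) with hfC
  have hfM0 : 0 ≤ fM := div_nonneg (by linarith [hs.2]) hden.le
  have hfC0 : 0 ≤ fC := div_nonneg (by linarith [hs.1]) hden.le
  have hsum : fM + fC = 1 := by rw [hfM, hfC]; field_simp; ring
  have hsmix : fM * sM + fC * sC = s := by rw [hfM, hfC]; field_simp; ring
  set w : ℝ := βh * fM / βM with hw'
  have hw0 : 0 ≤ w := div_nonneg (mul_nonneg hβh hfM0) hβM.le
  have hw1 : w < 1 := by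
    rw [hw', div_lt_one hβM, hfM]
    have h1 : βh * (sC - s) ≤ βh * (sC - s₁) := mul_le_mul_of_nonneg_left (by linarith [hs.1]) hβh
    calc βh * ((sC - s) / (sC - sM)) = βh * (sC - s) / (sC - sM) := by ring
      _ < βM := by rw [div_lt_iff₀ hden]; linarith
  have h1w : 0 < 1 - w := by linarith
  have h1wne : (1 - w) ≠ 0 := h1w.ne'
  -- the reduced coupling U₀ = fM UM + fC UC ∈ [0, U₁]
  set U₀ : ℝ := fM * UM + fC * UC with hU₀
  have hU₀0 : 0 ≤ U₀ := add_nonneg (mul_nonneg hfM0 hUM) (mul_nonneg hfC0 hUC)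
  have hU₀1 : U₀ ≤ U₁ := by
    -- the budget is affine in s: combine the two end inequalities with weights θ = (s - s₁)/(s₂ - s₁) when s₁ < s₂
    have key : (sC - s) * UM + (s - sM) * UC ≤ U₁ * (sC - sM) := by
      rcases eq_or_lt_of_le (show s₁ ≤ s₂ from hs.1.trans hs.2) with h12 | h12
      · have : s = s₁ := le_antisymm (h12 ▸ hs.2) hs.1
        rw [this]; exact hU1
      · have hθ0 : 0 ≤ (s - s₁) / (s₂ - s₁) := div_nonneg (by linarith [hs.1]) (by linarith)
        have hθ1 : 0 ≤ (s₂ - s) / (s₂ - s₁) := div_nonneg (by linarith [hs.2]) (by linarith)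
        have e1 := mul_le_mul_of_nonneg_left hU1 hθ1
        have e2 := mul_le_mul_of_nonneg_left hU2 hθ0
        have hid : (s₂ - s) / (s₂ - s₁) * ((sC - s₁) * UM + (s₁ - sM) * UC) +
            (s - s₁) / (s₂ - s₁) * ((sC - s₂) * UM + (s₂ - sM) * UC) = (sC - s) * UM + (s - sM) * UC := by
          field_simp; ring
        have hid2 : (s₂ - s) / (s₂ - s₁) * (U₁ * (sC - sM)) + (s - s₁) / (s₂ - s₁) * (U₁ * (sC - sM)) =
            U₁ * (sC - sM) := by
          field_simp; ring
        linarith [hid, hid2]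
    rw [hU₀, hfM, hfC, div_mul_eq_mul_div, div_mul_eq_mul_div, ← add_div, div_le_iff₀ hden]
    linarith
  -- corner data
  set βC : ℝ := βh * fC / (1 - w) with hβC
  have hβC0 : 0 ≤ βC := div_nonneg (mul_nonneg hβh hfC0) h1w.le
  have e1 : w * βM = βh * fM := by rw [hw']; field_simp
  have e2 : (1 - w) * βC = βh * fC := by rw [hβC]; field_simp
  have uM : pressureTT' βM 1 sM UM 1 ≤ piM := hM
  have uC : pressureTT' βC 1 sC UC 1 ≤ 2 * Real.log 2 - βC * Fc := by
    have h := (pressureTT'_mem_Icc hβC0 1 sC hUC zero_le_one one_lt_two).2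
    have hH : Real.binEntropy ((1 : ℝ) / 2) = Real.log 2 := by
      rw [one_div]; exact Real.binEntropy_two_inv
    rw [hH] at h
    have : βC * Fc ≤ βC * energyDensityTT' 1 sC UC 1 := mul_le_mul_of_nonneg_left hF hβC0
    linarith
  have hsumC := pressureTT'_le_sum zero_le_one one_lt_two (Finset.univ : Finset (Fin 2)) ![w, 1 - w] ![βM, βC]
    ![((1 : ℝ), sM, UM), ((1 : ℝ), sC, UC)] ![piM, 2 * Real.log 2 - βC * Fc]
    (by intro k _; fin_cases k <;> simp <;> linarith) (by simp [Fin.sum_univ_two])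
    (by intro k _; fin_cases k <;> simp <;> positivity) (by intro k _; fin_cases k <;> simp <;> linarith) hβh
    (q := ((1 : ℝ), s, U₀)) (by simpa using hU₀0)
    (by
      have ht : w * βM + (1 - w) * βC = βh := by
        rw [e1, e2, ← mul_add, hsum, mul_one]
      have hs' : w * (βM * sM) + (1 - w) * (βC * sC) = βh * s := by
        rw [← mul_assoc, ← mul_assoc, e1, e2]; linear_combination βh * hsmix
      have hU' : w * (βM * UM) + (1 - w) * (βC * UC) = βh * U₀ := by
        rw [← mul_assoc, ← mul_assoc, e1, e2, hU₀]; ring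
      ext <;> simp [Fin.sum_univ_two] <;> linarith [ht, hs', hU'])
    (by intro k _; fin_cases k
        · simpa using uM
        · simpa using uC)
  have h2 := hsumC
  simp only [Fin.sum_univ_two, Matrix.cons_val_zero, Matrix.cons_val_one] at h2
  -- h2 : p(βh; 1, s, U₀; 1) ≤ w * piM + (1 - w) * (2 log 2 - βC * Fc)
  have hanti : pressureTT' βh 1 s U 1 ≤ pressureTT' βh 1 s U₀ 1 :=
    pressureTT'_anti_U zero_le_one one_lt_two hβh 1 s hU₀0 (hU₀1.trans hU.1)
  have hL : Real.log 2 ≤ 6931471808 / 10 ^ 10 := by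
    have := Real.log_two_lt_d9; norm_num at this ⊢; linarith
  have hcold : (1 - w) * (2 * Real.log 2 - βC * Fc) = (1 - w) * (2 * Real.log 2) - βh * fC * Fc := by
    rw [← e2]; ring
  have hmono : (1 - w) * (2 * Real.log 2) ≤ (1 - w) * (2 * (6931471808 / 10 ^ 10)) :=
    mul_le_mul_of_nonneg_left (by linarith) h1w.le
  have hgoal : w * piM + (1 - w) * (2 * Real.log 2 - βC * Fc) ≤
      (1 - w) * (2 * (6931471808 / 10 ^ 10)) + w * piM - βh * fC * Fc := by
    rw [hcold]; linarith
  calc pressureTT' βh 1 s U 1 ≤ pressureTT' βh 1 s U₀ 1 := hanti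
    _ ≤ w * piM + (1 - w) * (2 * Real.log 2 - βC * Fc) := h2
    _ ≤ (1 - w) * (2 * (6931471808 / 10 ^ 10)) + w * piM - βh * fC * Fc := hgoal
    _ = (1 - βh * ((sC - s) / (sC - sM)) / βM) * (2 * (6931471808 / 10 ^ 10)) +
        βh * ((sC - s) / (sC - sM)) / βM * piM - βh * ((s - sM) / (sC - sM)) * Fc := by
          rw [hw', hfM, hfC]

end ThermodynamicLimit

end Literature.MathematicalPhysics.QuantumLattice
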